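import Mathlib.Analysis.SpecialFunctions.Pow.Real
import Mathlib.Analysis.SpecialFunctions.Sqrt
import Summits.QuantumFields.BalabanUV.Beta.EriceFlowEnclosureCesaroTauberianSeq

/-!
# Beta / EriceFlowEnclosureCesaroTauberianSeqRate — THE SQUARE-ROOT LAW FOR SEQUENCES: UNDOING A CESÀRO AVERAGE OVER CUTOFFS COSTS EXACTLY A
# SQUARE ROOT IN THE RATE (pure [folklore] SERVICE, the discrete twin of P2 #51a `sqrt_law` ∕ row L112; imports P2 #53a only).
# For a : ℕ → ℝ ASYMPTOTICALLY LOG-LIPSCHITZ — `|a i − a N| ≤ K·log(i∕N) + τ` on the windows N₀ ≤ N ≤ i ≤ 2N (τ ≥ 0 a slack: the sampled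
# three-loop Cesàro mean along the cutoff couplings is log-Lipschitz only up to the two-loop clock's error) — and Cesàro means within E of m
# on [N, 3N] (0 < E ≤ 1):   **`|a N − m| ≤ (K + 3)·√E + τ + (K + 1)∕N`**   (`sqrt_law`; window [N, N + ⌈√E·N⌉[ in P2 #53a `one_scale`; only the
# windows [N, 2N] (values) and [N, 3N] (means) are read; the 1∕N term is the price of integer windows).  Corollaries: the EVENTUAL form with an antitone Cesàro-rate function (`sqrt_law_eventually`) and
# the POWER form — Cesàro rate `A∕n^γ` ⟹ `|a N − m| ≤ (K + 3)√A·N^(−γ∕2) + τ + (K + 1)∕N` (`power_rate`): exponent γ ↦ γ∕2, ONE HALVING, as on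
# the continuum side (rows L112 ∕ L122 ∕ L125).
# (β-flow team, prover 2 = lower ∕ positivity side, unit `b2b-balaban-beta-bflow-p2`, gen 36; module P2 #53d; no Erice sentence occurs)

HONEST FRAMING (page 1 of everything the β sub-cell writes): discharging `BetaPertH` makes Bałaban's UV stability UNCONDITIONAL — a
real constructive-QFT result; it is NOT the continuum limit and NOT the Clay problem.  HONEST DEPENDENCY (cell reorg 2026-08-19,
verbatim): «continuum YM on T⁴ ⇐ BetaPertH ∧ nine spine estimates (0/9 proved); BetaPertH ⇐ (D1) ∧ (D4) ∧ CAP+tail; G-an2-4 gates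
asym, D1 and NE2/3/4.»  THIS MODULE DISCHARGES NOTHING and quotes nothing: [folklore] real analysis about real sequences (the quantitative
form of R. Schmidt's one-scale argument; cf. Hardy, Divergent Series §6.3, and the «O-Tauberian» remainder estimates of Ganelius, LNM 232 Ch. 1).

THE POINT.  In P2 #53a `one_scale` take J := N + ⌈√E·N⌉: then `J − N ∈ [√E·N, √E·N + 1[`, `log(J∕N) ≤ (J − N)∕N ≤ √E + 1∕N`, and the quotient
error `(J + N)E∕(J − N) ≤ (2 + √E)√E + √E∕N ≤ 3√E + 1∕N`; every i of the window has i ≤ 2N, where the log-Lipschitz slack hypothesis lives.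

WHAT THIS FILE PROVES (0 sorry, 0 def): `window_index`, HEADLINE **`sqrt_law`**, `sqrt_law_eventually`, **`power_rate`**.
NOT CLAIMED: optimality of the constant; the clock-rate version for the sampled Cesàro mean (row L119's `(1 + log K)∕K` enters τ — a successor
module); `BetaPertH`; continuum; Clay.
-/

namespace Summit.QuantumFields.BalabanUV.Beta.EriceFlowEnclosureCesaroTauberianSeqRate

open Finset Filter Topology
open Summit.QuantumFields.BalabanUV.Beta.EriceFlowEnclosureCesaroTauberianSeq (one_scale)

noncomputable section

variable {a : ℕ → ℝ}

/-- The window index J := N + ⌈r·N⌉₊ for 0 < r ≤ 1 and N ≥ 1: `N < J ≤ 3N`, `r·N ≤ J − N < r·N + 1`, hence every i < J has `i ≤ 2N`, and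
`log(J∕N) ≤ r + 1∕N`. [folklore] -/
theorem window_index {r : ℝ} (hr0 : 0 < r) (hr1 : r ≤ 1) {N : ℕ} (hN : 1 ≤ N) :
    N < N + ⌈r * (N : ℝ)⌉₊ ∧ N + ⌈r * (N : ℝ)⌉₊ ≤ 3 * N ∧
      r * N ≤ ((N + ⌈r * (N : ℝ)⌉₊ : ℕ) : ℝ) - N ∧ ((N + ⌈r * (N : ℝ)⌉₊ : ℕ) : ℝ) - N < r * N + 1 ∧
      (∀ i : ℕ, i < N + ⌈r * (N : ℝ)⌉₊ → i ≤ 2 * N) ∧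
      Real.log (((N + ⌈r * (N : ℝ)⌉₊ : ℕ) : ℝ) / N) ≤ r + 1 / N := by
  have hNpos : 0 < (N : ℝ) := Nat.cast_pos.mpr (lt_of_lt_of_le Nat.one_pos hN)
  have hN1 : (1 : ℝ) ≤ N := by exact_mod_cast hN
  have hrN : 0 < r * N := mul_pos hr0 hNpos
  have hce : r * N ≤ ⌈r * (N : ℝ)⌉₊ := Nat.le_ceil _
  have hlt : (⌈r * (N : ℝ)⌉₊ : ℝ) < r * N + 1 := Nat.ceil_lt_add_one hrN.le
  have hDpos : 0 < ⌈r * (N : ℝ)⌉₊ := Nat.ceil_pos.mpr hrN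
  have hcast : ((N + ⌈r * (N : ℝ)⌉₊ : ℕ) : ℝ) = N + ⌈r * (N : ℝ)⌉₊ := by push_cast; ring
  refine ⟨by omega, ?_, by rw [hcast]; linarith, by rw [hcast]; linarith, fun i hi => ?_, ?_⟩
  · -- J ≤ N + rN + 1 ≤ 2N + 1 ≤ 3N
    have h3 : ((N + ⌈r * (N : ℝ)⌉₊ : ℕ) : ℝ) ≤ 3 * N := by rw [hcast]; nlinarith
    exact_mod_cast h3
  · -- i ≤ N + D − 1 ≤ N + r N ≤ 2N as reals, hence as naturals
    have hi' : (i : ℝ) + 1 ≤ N + ⌈r * (N : ℝ)⌉₊ := by exact_mod_cast hi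
    have h2 : (i : ℝ) ≤ 2 * N := by nlinarith
    exact_mod_cast h2
  · have hD0 : (0 : ℝ) ≤ (⌈r * (N : ℝ)⌉₊ : ℝ) := Nat.cast_nonneg _
    have hJN : 1 ≤ ((N + ⌈r * (N : ℝ)⌉₊ : ℕ) : ℝ) / N := by
      rw [hcast, le_div_iff₀ hNpos]; linarith
    have hpos : 0 < ((N + ⌈r * (N : ℝ)⌉₊ : ℕ) : ℝ) / N := by linarith
    have hnum : ((N + ⌈r * (N : ℝ)⌉₊ : ℕ) : ℝ) - N ≤ r * N + 1 := by rw [hcast]; linarith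
    calc Real.log (((N + ⌈r * (N : ℝ)⌉₊ : ℕ) : ℝ) / N) ≤ ((N + ⌈r * (N : ℝ)⌉₊ : ℕ) : ℝ) / N - 1 :=
          Real.log_le_sub_one_of_pos hpos
      _ = (((N + ⌈r * (N : ℝ)⌉₊ : ℕ) : ℝ) - N) / N := by field_simp
      _ ≤ (r * N + 1) / N := div_le_div_of_nonneg_right hnum hNpos.le
      _ = r + 1 / N := by field_simp

/-- **THE SQUARE-ROOT LAW FOR SEQUENCES (HEADLINE; everything AT N).**  N ≥ 1; if `|a i − a N| ≤ K·log(i∕N) + τ` for `N ≤ i ≤ 2N` (K ≥ 0,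
any slack τ) and the Cesàro means satisfy `|n⁻¹·Σ_{i<n} a i − m| ≤ E` for `N ≤ n ≤ 3N` (0 < E ≤ 1), then
**`|a N − m| ≤ (K + 3)·√E + τ + (K + 1)∕N`** — only the windows [N, 2N] (values) and [N, 3N] (means) are looked at.
[folklore] (the discrete twin of P2 #51a `sqrt_law`) -/
theorem sqrt_law {K τ m E : ℝ} (hK : 0 ≤ K) {N : ℕ} (hN1 : 1 ≤ N) (hE0 : 0 < E) (hE1 : E ≤ 1)
    (hlip : ∀ i : ℕ, N ≤ i → i ≤ 2 * N → |a i - a N| ≤ K * Real.log ((i : ℝ) / N) + τ)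
    (hces : ∀ n : ℕ, N ≤ n → n ≤ 3 * N → |(n : ℝ)⁻¹ * ∑ i ∈ range n, a i - m| ≤ E) :
    |a N - m| ≤ (K + 3) * Real.sqrt E + τ + (K + 1) / N := by
  set r := Real.sqrt E with hr
  have hr0 : 0 < r := Real.sqrt_pos.mpr hE0
  have hr1 : r ≤ 1 := by rw [hr]; exact Real.sqrt_le_one.mpr hE1 |>.trans_eq' rfl
  have hrr : r * r = E := by rw [hr]; exact Real.mul_self_sqrt hE0.le
  have hNpos : 0 < (N : ℝ) := Nat.cast_pos.mpr (lt_of_lt_of_le Nat.one_pos hN1)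
  obtain ⟨hNJ, hJ3, hDlo, hDhi, hwin, hlog⟩ := window_index hr0 hr1 hN1
  set J : ℕ := N + ⌈r * (N : ℝ)⌉₊ with hJ
  -- the window bound w = K log(J/N) + τ
  have hw : ∀ i, N ≤ i → i < J → |a i - a N| ≤ K * Real.log ((J : ℝ) / N) + τ := by
    intro i h1 h2
    have hipos : 0 < (i : ℝ) := lt_of_lt_of_le hNpos (Nat.cast_le.mpr h1)
    have hmono : Real.log ((i : ℝ) / N) ≤ Real.log ((J : ℝ) / N) :=
      Real.log_le_log (div_pos hipos hNpos) (div_le_div_of_nonneg_right (Nat.cast_le.mpr h2.le) hNpos.le)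
    calc |a i - a N| ≤ K * Real.log ((i : ℝ) / N) + τ := hlip i h1 (hwin i h2)
      _ ≤ K * Real.log ((J : ℝ) / N) + τ := by gcongr
  have h := one_scale hNJ hw (hces J hNJ.le hJ3) (hces N le_rfl (by omega))
  -- bound the two terms
  have hJN : 0 < (J : ℝ) - N := by linarith [mul_pos hr0 hNpos]
  have hlogb : K * Real.log ((J : ℝ) / N) ≤ K * (r + 1 / N) := mul_le_mul_of_nonneg_left hlog hK
  have hquot : ((J : ℝ) * E + N * E) / ((J : ℝ) - N) ≤ 3 * r + 1 / N := by
    rw [div_le_iff₀ hJN]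
    -- (J + N) E ≤ (3r + 1/N)(J − N), using r N ≤ J − N, J − N < rN + 1, E = r², r ≤ 1
    have hJle : (J : ℝ) ≤ N + r * N + 1 := by linarith
    have h1 : (J : ℝ) * E + N * E ≤ (2 * N + r * N + 1) * (r * r) := by rw [hrr]; nlinarith
    have h2 : (2 * N + r * N + 1) * (r * r) ≤ (3 * r + 1 / N) * (r * N) := by
      have key : (3 * r + 1 / N) * (r * N) = 3 * (r * r) * N + r := by field_simp
      rw [key]
      nlinarith [mul_nonneg (mul_nonneg (mul_self_nonneg r) hNpos.le) (sub_nonneg.mpr hr1),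
        mul_nonneg hr0.le (sub_nonneg.mpr hr1)]
    have h3 : (3 * r + 1 / N) * (r * N) ≤ (3 * r + 1 / N) * ((J : ℝ) - N) :=
      mul_le_mul_of_nonneg_left hDlo (by positivity)
    linarith
  calc |a N - m| ≤ K * Real.log ((J : ℝ) / N) + τ + ((J : ℝ) * E + N * E) / ((J : ℝ) - N) := h
    _ ≤ K * (r + 1 / N) + τ + (3 * r + 1 / N) := by linarith
    _ = (K + 3) * r + τ + (K + 1) / N := by ring

/-- **EVENTUAL FORM.**  Asymptotically log-Lipschitz from N₀ ≥ 1 on (`|a i − a N| ≤ K·log(i∕N) + τ` for N₀ ≤ N ≤ i ≤ 2N) with an ANTITONE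
Cesàro-rate function ε (`|σ n − m| ≤ ε n` for n ≥ N₀, `0 < ε n ≤ 1`): for every `N ≥ N₀`, **`|a N − m| ≤ (K + 3)·√(ε N) + τ + (K + 1)∕N`**. [folklore] -/
theorem sqrt_law_eventually {K τ m : ℝ} (hK : 0 ≤ K) {N₀ : ℕ} (hN₀ : 1 ≤ N₀) {ε : ℕ → ℝ}
    (hε0 : ∀ n, 0 < ε n) (hε1 : ∀ n, ε n ≤ 1) (hanti : Antitone ε)
    (hlip : ∀ N i : ℕ, N₀ ≤ N → N ≤ i → i ≤ 2 * N → |a i - a N| ≤ K * Real.log ((i : ℝ) / N) + τ)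
    (hces : ∀ n : ℕ, N₀ ≤ n → |(n : ℝ)⁻¹ * ∑ i ∈ range n, a i - m| ≤ ε n) {N : ℕ} (hN : N₀ ≤ N) :
    |a N - m| ≤ (K + 3) * Real.sqrt (ε N) + τ + (K + 1) / N :=
  sqrt_law hK (hN₀.trans hN) (hε0 N) (hε1 N) (fun i h1 h2 => hlip N i hN h1 h2)
    fun n hn _ => (hces n (hN.trans hn)).trans (hanti hn)

/-- **THE POWER FORM — ONE HALVING.**  Cesàro rate `|σ n − m| ≤ A∕n^γ` for n ≥ N₀ (0 < A ≤ 1, 0 < γ — so the rate is ≤ 1 from N₀ ≥ 1 on) and the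
asymptotic log-Lipschitz bound ⟹ for every `N ≥ N₀`:  **`|a N − m| ≤ (K + 3)·√A·N^(−γ∕2) + τ + (K + 1)∕N`** — exponent γ ↦ γ∕2 (plus the
integer-window term 1∕N), the discrete twin of P2 #51a `power_rate`. [folklore] -/
theorem power_rate {K τ m A γ : ℝ} (hK : 0 ≤ K) {N₀ : ℕ} (hN₀ : 1 ≤ N₀) (hA0 : 0 < A) (hA1 : A ≤ 1) (hγ : 0 < γ)
    (hlip : ∀ N i : ℕ, N₀ ≤ N → N ≤ i → i ≤ 2 * N → |a i - a N| ≤ K * Real.log ((i : ℝ) / N) + τ)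
    (hces : ∀ n : ℕ, N₀ ≤ n → |(n : ℝ)⁻¹ * ∑ i ∈ range n, a i - m| ≤ A / (n : ℝ) ^ γ) {N : ℕ} (hN : N₀ ≤ N) :
    |a N - m| ≤ (K + 3) * Real.sqrt A * (N : ℝ) ^ (-(γ / 2)) + τ + (K + 1) / N := by
  have hpos : ∀ n : ℕ, 1 ≤ n → 0 < (n : ℝ) ^ γ := fun n hn =>
    Real.rpow_pos_of_pos (Nat.cast_pos.mpr (lt_of_lt_of_le Nat.one_pos hn)) γ
  have hε0 : ∀ n : ℕ, 0 < A / (max (n : ℝ) 1) ^ γ := fun n => by positivity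
  -- use ε n := A / (max n 1)^γ, antitone, ≤ 1, and equal to A/n^γ for n ≥ 1
  have hanti : Antitone (fun n : ℕ => A / (max (n : ℝ) 1) ^ γ) := by
    intro n n' hnn'
    apply div_le_div_of_nonneg_left hA0.le (by positivity)
    exact Real.rpow_le_rpow (by positivity) (max_le_max (Nat.cast_le.mpr hnn') le_rfl) hγ.le
  have hε1 : ∀ n : ℕ, A / (max (n : ℝ) 1) ^ γ ≤ 1 := fun n => by
    rw [div_le_one (by positivity)]
    exact hA1.trans (Real.one_le_rpow (le_max_right _ _) hγ.le)
  have heq : ∀ n : ℕ, 1 ≤ n → A / (max (n : ℝ) 1) ^ γ = A / (n : ℝ) ^ γ := fun n hn => by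
    rw [max_eq_left (by exact_mod_cast hn)]
  have h := sqrt_law_eventually (ε := fun n : ℕ => A / (max (n : ℝ) 1) ^ γ) hK hN₀ hε0 hε1 hanti hlip
    (fun n hn => by rw [heq n (hN₀.trans hn)]; exact hces n hn) hN
  have hN1 : 1 ≤ N := hN₀.trans hN
  have hNpos : 0 < (N : ℝ) := Nat.cast_pos.mpr (lt_of_lt_of_le Nat.one_pos hN1)
  rw [heq N hN1] at h
  have hsqrt : Real.sqrt (A / (N : ℝ) ^ γ) = Real.sqrt A * (N : ℝ) ^ (-(γ / 2)) := by
    rw [Real.sqrt_div' A (hpos N hN1).le, Real.sqrt_eq_rpow ((N : ℝ) ^ γ), ← Real.rpow_mul hNpos.le,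
      show γ * (1 / 2 : ℝ) = γ / 2 by ring, Real.rpow_neg hNpos.le, div_eq_mul_inv]
  calc |a N - m| ≤ (K + 3) * Real.sqrt (A / (N : ℝ) ^ γ) + τ + (K + 1) / N := h
    _ = (K + 3) * Real.sqrt A * (N : ℝ) ^ (-(γ / 2)) + τ + (K + 1) / N := by rw [hsqrt]; ring

end

end Summit.QuantumFields.BalabanUV.Beta.EriceFlowEnclosureCesaroTauberianSeqRate
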